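import Summits.AnomalousDissipation.AnomalousDissipation.Theorems.MirrorVarietyGalerkinSteadyZerothLawStubLoudCoatCoreTools
import Summits.AnomalousDissipation.AnomalousDissipation.Theorems.MirrorVarietyGalerkinSteadyZerothLawStubLoudCoatOfLadder

/-!
# The cell core of the line `idea-sketch-ideator2` (crux stmt-AnomalousDissipation-2986, `MirrorVariety.GalerkinSteadyZerothLaw`):
# planar single-shell fields are exact Euler cores at EVERY Galerkin level

`STUB-PLAN-stub_loudCoatDecades.md` §2.3, last line of the assembly: the heart `stub_loudCoatDecades` (and its
force-coordinate form `stub_steadyTubeLadder`) needs its core shape `Cfun` to restrict to an EXACT EULER CORE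
(`C ∈ galerkinSubspace`, `C ≠ 0`, `galerkinRHS (modes N) 0 0 C = 0`) at every level `N` carrying it; by the landed
`eulerCore_restrict` (B1) this costs ONE identity at level `2K₀`.  This file proves that identity once and for all for
the class the line actually uses — PLANAR SINGLE-SHELL cores — and instantiates it on the CELL core of the lead's kit
runs (`(sin 2πx cos 2πy, −cos 2πx sin 2πy, 0)`, `K₀ = 2`):

* `leraySym_eq_zero_of_parallel` — the Leray symbol kills vectors parallel to `k` (`v × k = 0`, `k ≠ 0`);
* `leraySym_convectionCoeff_eq_zero_of_planar_shell` — if a coefficient family on `T` is planar (`l₂ = 0` on `T`),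
  single-shell (`|l|² = n₀` on `T`) and in-plane transversal (`c l = a l • l^⊥`, `l^⊥ = (−l₁, l₀, 0)`), then
  `Π_k B_T(c, c)_k = 0` for every `k ≠ 0`: symmetrising the convolution in `(l, m)`, the pair `{l, m}` with
  `l + m = k` contributes `2πi a_l a_m (l^⊥·m) • (m − l)^⊥`, and `(m − l)^⊥ ∥ l + m` because `(m − l)·(m + l) =
  |m|² − |l|² = 0` (the coefficient-level form of "`ω = λψ` ⇒ `(u·∇)u` is a gradient");
* `cellShell`, `cellCoeff` — the four wavevectors `(±1, ±1, 0)` and the coefficients `(i l₀ l₁ / 4) • l^⊥` of the cell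
  flow; `isConjSymm_cellCoeff`, `cellCoeff_transversal`, `cellCoeff_eq_zero_of_not_mem`, `cellShell_subset_modes`;
* `cellCore_level_four` — the restriction to level `4 = 2·2` is a real solenoidal nonzero exact Euler core;
* `stub_cellCoreTools` (REGISTERED packaging) — support in `modes 2` and, by `eulerCore_restrict`, an exact Euler
  core at EVERY level `N ≥ 2`: the core clause of the heart for the cell core, discharged;
* `loudCoatDecades_of_cellLadder` — the hand-off to the lead: the registered heart `stub_loudCoatDecades` follows
  VERBATIM from connected loud-bounded families of Galerkin steady states of the FIXED cell force covering
  `[a j, r · a j]` (the force-coordinate ladder `stub_loudCoatOfLadder` with `Cfun := cellCoeff`, `K₀ := 2`, its core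
  clause supplied by `stub_cellCoreTools`) — for the cell core only the tube family is left open.

References: the plan `Cruxes/GalerkinSteadyZerothLaw/STUB-PLAN-stub_loudCoatDecades.md` §2.3; Majda–Bertozzi,
*Vorticity and Incompressible Flow* (2002), §2.2 (steady 2-D Euler flows with `ω = F(ψ)`; cellular/Taylor–Green
eddies); Robinson–Rodrigo–Sadowski 2016, (4.5) (Fourier–Galerkin system).
-/

noncomputable section

-- `Summit.<Summit>.<Problem>` is the tree's mandated summit-side namespace (CONVENTIONS §2); deliberate duplicate.
set_option linter.dupNamespace false

open scoped InnerProductSpace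
open MeasureTheory Filter Set
open Literature.Analysis.FunctionSpaces Literature.Analysis.FunctionSpaces.Torus
open Literature.Analysis.FluidPDE Literature.Analysis.FluidPDE.Torus

namespace Summit.AnomalousDissipation.AnomalousDissipation.Theorems.GalerkinSteadyZerothLaw

open Summit.AnomalousDissipation.AnomalousDissipation.Theorems.LaminarNeverLoud.Negative
  (modes energy dissipation modes_symm freqNormSq_le_of_mem_modes)

/-! ## §1 The Leray symbol kills parallel vectors -/

/-- **Parallel vectors are killed by the Leray symbol**: if `v × k = 0` (all `2 × 2` minors of `(v, k)` vanish) and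
`k ≠ 0`, then `Π_k v = v − ((k·v)/|k|²) k = 0`. [folklore] -/
theorem leraySym_eq_zero_of_parallel {k : Fin 3 → ℤ} (hk : k ≠ 0) {v : EuclideanSpace ℂ (Fin 3)}
    (h01 : v 0 * (k 1 : ℂ) = v 1 * (k 0 : ℂ)) (h02 : v 0 * (k 2 : ℂ) = v 2 * (k 0 : ℂ))
    (h12 : v 1 * (k 2 : ℂ) = v 2 * (k 1 : ℂ)) : leraySym k v = 0 := by
  have hq : ((freqNormSq k : ℝ) : ℂ) ≠ 0 := by
    rw [Ne, Complex.ofReal_eq_zero, freqNormSq_eq_zero_iff]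
    exact hk
  have hqe : ((freqNormSq k : ℝ) : ℂ) = (k 0 : ℂ) ^ 2 + (k 1 : ℂ) ^ 2 + (k 2 : ℂ) ^ 2 := by
    unfold freqNormSq
    push_cast
    simp only [Fin.sum_univ_three]
  have hdot : ∑ i, (k i : ℂ) * v i = (k 0 : ℂ) * v 0 + (k 1 : ℂ) * v 1 + (k 2 : ℂ) * v 2 := by
    simp only [Fin.sum_univ_three]
  rw [leraySym_def, hdot, sub_eq_zero]
  ext i
  rw [PiLp.smul_apply, freqVec_apply, smul_eq_mul]
  field_simp
  rw [hqe]
  fin_cases i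
  · show v 0 * ((k 0 : ℂ) ^ 2 + (k 1 : ℂ) ^ 2 + (k 2 : ℂ) ^ 2) = ((k 0 : ℂ) * v 0 + (k 1 : ℂ) * v 1 + (k 2 : ℂ) * v 2) * (k 0 : ℂ)
    linear_combination (k 1 : ℂ) * h01 + (k 2 : ℂ) * h02
  · show v 1 * ((k 0 : ℂ) ^ 2 + (k 1 : ℂ) ^ 2 + (k 2 : ℂ) ^ 2) = ((k 0 : ℂ) * v 0 + (k 1 : ℂ) * v 1 + (k 2 : ℂ) * v 2) * (k 1 : ℂ)
    linear_combination -(k 0 : ℂ) * h01 + (k 2 : ℂ) * h12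
  · show v 2 * ((k 0 : ℂ) ^ 2 + (k 1 : ℂ) ^ 2 + (k 2 : ℂ) ^ 2) = ((k 0 : ℂ) * v 0 + (k 1 : ℂ) * v 1 + (k 2 : ℂ) * v 2) * (k 2 : ℂ)
    linear_combination -(k 0 : ℂ) * h02 - (k 1 : ℂ) * h12

/-! ## §2 Planar single-shell families are exact Euler cores (`Π B(c, c) = 0`) -/

/-- **Planar single-shell in-plane-transversal families have Leray-trivial self-convection.**  Let `T` be a finite
set of wavevectors with `l₂ = 0` and `|l|² = n₀` for `l ∈ T`, and `c l = a l • l^⊥` on `T`, `l^⊥ := (−l₁, l₀, 0)`.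
Then `Π_k (convectionCoeff T c c k) = 0` for every `k ≠ 0`.  Proof: write the convolution as a double sum and add it
to itself with `(l, m)` swapped; for `l + m = k` the pair contributes `2πi a_l a_m (l^⊥·m) • (m^⊥ − l^⊥)`
(`m^⊥·l = −l^⊥·m`), and `(m − l)^⊥ × (l + m) = (|l|² − |m|²) e₃ = 0` on one shell, so the Leray symbol kills every
pair (`leraySym_eq_zero_of_parallel`). [folklore] -/
theorem leraySym_convectionCoeff_eq_zero_of_planar_shell {T : Finset (Fin 3 → ℤ)} {n₀ : ℝ}
    {c : (Fin 3 → ℤ) → EuclideanSpace ℂ (Fin 3)} (a : (Fin 3 → ℤ) → ℂ)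
    (hT2 : ∀ l ∈ T, l 2 = 0) (hTn : ∀ l ∈ T, freqNormSq l = n₀)
    (hc : ∀ l ∈ T, c l = a l • !₂[-((l 1 : ℤ) : ℂ), ((l 0 : ℤ) : ℂ), 0])
    {k : Fin 3 → ℤ} (hk : k ≠ 0) :
    leraySym k (convectionCoeff T c c k) = 0 := by
  -- the summand of the convolution and its symmetrisation
  set t : (Fin 3 → ℤ) → (Fin 3 → ℤ) → EuclideanSpace ℂ (Fin 3) := fun l m =>
    if l + m = k then (2 * Real.pi * Complex.I * ∑ j, c l j * (m j : ℂ)) • c m else 0 with ht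
  have hconv : convectionCoeff T c c k = ∑ l ∈ T, ∑ m ∈ T, t l m := by
    rw [convectionCoeff_def]
  have hswap : ∑ l ∈ T, ∑ m ∈ T, t l m = ∑ l ∈ T, ∑ m ∈ T, t m l := Finset.sum_comm
  -- coordinates of the in-plane family
  have hc0 : ∀ l ∈ T, c l 0 = -(a l * (l 1 : ℂ)) := by
    intro l hl
    rw [hc l hl]
    simp
  have hc1 : ∀ l ∈ T, c l 1 = a l * (l 0 : ℂ) := by
    intro l hl
    rw [hc l hl]
    simp
  have hc2 : ∀ l ∈ T, c l 2 = 0 := by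
    intro l hl
    rw [hc l hl]
    simp
  -- the dot product `c l · m = a l ω(l, m)`, `ω(l, m) = l₀ m₁ − l₁ m₀`
  have hdot : ∀ l ∈ T, ∀ m : Fin 3 → ℤ,
      ∑ j, c l j * (m j : ℂ) = a l * ((l 0 : ℂ) * (m 1 : ℂ) - (l 1 : ℂ) * (m 0 : ℂ)) := by
    intro l hl m
    simp only [Fin.sum_univ_three, hc0 l hl, hc1 l hl, hc2 l hl]
    ring
  -- every symmetrised pair is killed by the Leray symbol
  have hpair : ∀ l ∈ T, ∀ m ∈ T, leraySym k (t l m + t m l) = 0 := by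
    intro l hl m hm
    by_cases hlm : l + m = k
    · have hml : m + l = k := by rw [add_comm]; exact hlm
      simp only [ht, if_pos hlm, if_pos hml, hdot l hl, hdot m hm]
      -- the pair is `α • (m^⊥ − l^⊥)` with `α = 2πi a_l a_m ω(l,m)`; it is parallel to `k = l + m`
      have hl2 := hT2 l hl
      have hm2 := hT2 m hm
      have hshell : ((l 0 : ℤ) : ℂ) ^ 2 + ((l 1 : ℤ) : ℂ) ^ 2 = ((m 0 : ℤ) : ℂ) ^ 2 + ((m 1 : ℤ) : ℂ) ^ 2 := by
        have hl' := hTn l hl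
        have hm' := hTn m hm
        unfold freqNormSq at hl' hm'
        simp only [Fin.sum_univ_three, hl2, hm2, Int.cast_zero] at hl' hm'
        have h : ((l 0 : ℤ) : ℝ) ^ 2 + ((l 1 : ℤ) : ℝ) ^ 2 = ((m 0 : ℤ) : ℝ) ^ 2 + ((m 1 : ℤ) : ℝ) ^ 2 := by
          linarith
        exact_mod_cast congrArg Complex.ofReal h
      have hk0 : (k 0 : ℂ) = (l 0 : ℂ) + (m 0 : ℂ) := by rw [← hlm]; push_cast [Pi.add_apply]; ring
      have hk1 : (k 1 : ℂ) = (l 1 : ℂ) + (m 1 : ℂ) := by rw [← hlm]; push_cast [Pi.add_apply]; ring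
      have hk2 : (k 2 : ℂ) = 0 := by rw [← hlm]; push_cast [Pi.add_apply, hl2, hm2]; ring
      refine leraySym_eq_zero_of_parallel hk ?_ ?_ ?_
      · simp only [PiLp.add_apply, PiLp.smul_apply, smul_eq_mul, hc0 l hl, hc1 l hl, hc0 m hm, hc1 m hm, hk0, hk1]
        linear_combination (2 * ↑Real.pi * Complex.I) * a l * a m *
          ((l 0 : ℂ) * (m 1 : ℂ) - (l 1 : ℂ) * (m 0 : ℂ)) * hshell
      · simp only [PiLp.add_apply, PiLp.smul_apply, smul_eq_mul, hc0 l hl, hc2 l hl, hc0 m hm, hc2 m hm, hk2]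
        ring
      · simp only [PiLp.add_apply, PiLp.smul_apply, smul_eq_mul, hc1 l hl, hc2 l hl, hc1 m hm, hc2 m hm, hk2]
        ring
    · have hml : ¬ m + l = k := by rw [add_comm]; exact hlm
      simp only [ht, if_neg hlm, if_neg hml, add_zero, leraySym_zero]
  -- symmetrise: `2 Π_k B = Σ_l Σ_m Π_k (t l m + t m l) = 0`
  have htwo : (2 : ℂ) • leraySym k (convectionCoeff T c c k) = 0 := by
    rw [two_smul, ← leraySym_add]
    conv_lhs => rw [hconv]; arg 2; arg 2; rw [hswap]
    rw [← Finset.sum_add_distrib]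
    simp_rw [← Finset.sum_add_distrib]
    rw [← leraySymₗ_apply, map_sum]
    refine Finset.sum_eq_zero fun l hl => ?_
    rw [map_sum]
    refine Finset.sum_eq_zero fun m hm => ?_
    rw [leraySymₗ_apply]
    exact hpair l hl m hm
  exact (smul_eq_zero.1 htwo).resolve_left two_ne_zero

/-! ## §3 The cell core: `(sin 2πx cos 2πy, −cos 2πx sin 2πy, 0)` in Fourier coordinates -/

/-- The cell shell: the four wavevectors `(±1, ±1, 0)` (`|k|² = 2`). -/
def cellShell : Finset (Fin 3 → ℤ) := Fintype.piFinset ![({1, -1} : Finset ℤ), {1, -1}, {0}]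

/-- The Fourier coefficients of the cell flow `u = (sin 2πx₀ cos 2πx₁, −cos 2πx₀ sin 2πx₁, 0)`:
`û(l) = (i l₀ l₁ / 4) • l^⊥ = ¼ (−i l₀, i l₁, 0)` on the cell shell, `0` elsewhere. -/
def cellCoeff (l : Fin 3 → ℤ) : EuclideanSpace ℂ (Fin 3) :=
  if l ∈ cellShell then (Complex.I * (l 0 : ℂ) * (l 1 : ℂ) / 4) • !₂[-((l 1 : ℤ) : ℂ), ((l 0 : ℤ) : ℂ), 0] else 0

/-- Membership in the cell shell, coordinatewise. [folklore] -/
theorem mem_cellShell_iff (l : Fin 3 → ℤ) :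
    l ∈ cellShell ↔ (l 0 = 1 ∨ l 0 = -1) ∧ (l 1 = 1 ∨ l 1 = -1) ∧ l 2 = 0 := by
  rw [cellShell, Fintype.mem_piFinset, Fin.forall_fin_succ, Fin.forall_fin_two]
  simp

/-- Off the cell shell the cell coefficients vanish. [folklore] -/
theorem cellCoeff_eq_zero_of_not_mem {l : Fin 3 → ℤ} (hl : l ∉ cellShell) : cellCoeff l = 0 := by
  rw [cellCoeff, if_neg hl]

/-- On the cell shell the cell coefficients are `(i l₀ l₁ / 4) • l^⊥`. [folklore] -/
theorem cellCoeff_of_mem {l : Fin 3 → ℤ} (hl : l ∈ cellShell) :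
    cellCoeff l = (Complex.I * (l 0 : ℂ) * (l 1 : ℂ) / 4) • !₂[-((l 1 : ℤ) : ℂ), ((l 0 : ℤ) : ℂ), 0] := by
  rw [cellCoeff, if_pos hl]

/-- The cell shell is symmetric. [folklore] -/
theorem neg_mem_cellShell {l : Fin 3 → ℤ} (hl : l ∈ cellShell) : -l ∈ cellShell := by
  rw [mem_cellShell_iff] at hl ⊢
  simp only [Pi.neg_apply, neg_eq_iff_eq_neg, neg_neg]
  omega

/-- Shell vectors are planar with `|l|² = 2`. [folklore] -/
theorem freqNormSq_of_mem_cellShell {l : Fin 3 → ℤ} (hl : l ∈ cellShell) : l 2 = 0 ∧ freqNormSq l = 2 := by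
  rw [mem_cellShell_iff] at hl
  obtain ⟨h0, h1, h2⟩ := hl
  refine ⟨h2, ?_⟩
  unfold freqNormSq
  simp only [Fin.sum_univ_three, h2, Int.cast_zero]
  rcases h0 with h0 | h0 <;> rcases h1 with h1 | h1 <;> simp [h0, h1] <;> norm_num

/-- The cell shell lies in the punctured ball of radius `2`. [folklore] -/
theorem cellShell_subset_modes : cellShell ⊆ modes (Fin 3) 2 := by
  intro l hl
  have hn := (freqNormSq_of_mem_cellShell hl).2
  rw [Finset.mem_erase, mem_freqBall]
  refine ⟨fun h0 => ?_, by rw [hn]; norm_num⟩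
  rw [h0, freqNormSq_zero] at hn
  norm_num at hn

/-- The cell coefficients satisfy the reality condition `û(−l) = conj û(l)`. [folklore] -/
theorem isConjSymm_cellCoeff : IsConjSymm cellCoeff := by
  intro l
  by_cases hl : l ∈ cellShell
  · rw [cellCoeff_of_mem hl, cellCoeff_of_mem (neg_mem_cellShell hl), EuclideanSpace.conjVec_smul]
    have hconj : starRingEnd ℂ (Complex.I * (l 0 : ℂ) * (l 1 : ℂ) / 4) = -(Complex.I * (l 0 : ℂ) * (l 1 : ℂ) / 4) := by
      rw [map_div₀, map_mul, map_mul, Complex.conj_I, map_intCast, map_intCast, map_ofNat]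
      ring
    rw [hconj]
    ext i
    fin_cases i <;> simp [EuclideanSpace.conjVec_apply]
  · have hnl : -l ∉ cellShell := fun h => hl (by simpa using neg_mem_cellShell h)
    rw [cellCoeff_eq_zero_of_not_mem hl, cellCoeff_eq_zero_of_not_mem hnl, EuclideanSpace.conjVec_zero]

/-- The cell coefficients are transversal: `l · û(l) = 0`. [folklore] -/
theorem cellCoeff_transversal (l : Fin 3 → ℤ) : ∑ j, ((l j : ℤ) : ℂ) * cellCoeff l j = 0 := by
  by_cases hl : l ∈ cellShell
  · rw [cellCoeff_of_mem hl]
    simp only [Fin.sum_univ_three, PiLp.smul_apply, smul_eq_mul]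
    simp
    ring
  · rw [cellCoeff_eq_zero_of_not_mem hl]
    simp

/-- The cell core is not zero: its coefficient at `(1, 1, 0)` has second component `i/4`. [folklore] -/
theorem cellCoeff_one_one_ne_zero : cellCoeff ![1, 1, 0] ≠ 0 := by
  have hmem : (![1, 1, 0] : Fin 3 → ℤ) ∈ cellShell := by
    rw [mem_cellShell_iff]
    simp
  intro h
  have h1 := congrArg (fun v : EuclideanSpace ℂ (Fin 3) => v 1) h
  simp only [cellCoeff_of_mem hmem, PiLp.smul_apply, smul_eq_mul, PiLp.zero_apply] at h1
  simp [Complex.ext_iff] at h1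

/-! ## §4 The cell core at level `4 = 2 · 2` -/

/-- **The cell core is an exact Euler core at level `2·2`**: the restriction of `cellCoeff` to `modes 4` is real,
solenoidal, nonzero and annihilated by the unforced inviscid Galerkin field (`Π B(C, C) = 0`, by
`leraySym_convectionCoeff_eq_zero_of_planar_shell` on the cell shell with `a l = i l₀ l₁ / 4`). [folklore] -/
theorem cellCore_level_four :
    (fun k : ↥(modes (Fin 3) (2 * 2)) => cellCoeff k) ∈ galerkinSubspace (modes (Fin 3) (2 * 2)) ∧
      (fun k : ↥(modes (Fin 3) (2 * 2)) => cellCoeff k) ≠ 0 ∧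
      galerkinRHS (modes (Fin 3) (2 * 2)) 0 0 (fun k : ↥(modes (Fin 3) (2 * 2)) => cellCoeff k) = 0 := by
  have hsub : cellShell ⊆ modes (Fin 3) (2 * 2) := cellShell_subset_modes.trans (modes_mono (by norm_num))
  have hext : coeffExt (modes (Fin 3) (2 * 2)) (fun k : ↥(modes (Fin 3) (2 * 2)) => cellCoeff k) = cellCoeff := by
    funext l
    by_cases hl : l ∈ modes (Fin 3) (2 * 2)
    · rw [coeffExt_of_mem _ hl]
    · rw [coeffExt_of_not_mem _ hl, cellCoeff_eq_zero_of_not_mem fun h => hl (hsub h)]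
  refine ⟨⟨isRealCoeff_restrict isConjSymm_cellCoeff, fun k => cellCoeff_transversal k⟩, ?_, ?_⟩
  · intro h0
    have hmem : (![1, 1, 0] : Fin 3 → ℤ) ∈ modes (Fin 3) (2 * 2) := by
      refine hsub ?_
      rw [mem_cellShell_iff]
      simp
    exact cellCoeff_one_one_ne_zero (congrFun h0 ⟨![1, 1, 0], hmem⟩)
  · funext k
    rw [galerkinRHS_apply, galerkinField_def, coeffExt_zero, hext,
      convectionCoeff_of_support hsub (fun l hl => cellCoeff_eq_zero_of_not_mem hl)
        (fun l hl => cellCoeff_eq_zero_of_not_mem hl)]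
    simp only [zero_mul, Complex.ofReal_zero, zero_smul, neg_zero, zero_add, Pi.zero_apply, zero_sub, leraySym_neg,
      neg_eq_zero]
    refine leraySym_convectionCoeff_eq_zero_of_planar_shell (n₀ := 2) (fun l => Complex.I * (l 0 : ℂ) * (l 1 : ℂ) / 4)
      (fun l hl => (freqNormSq_of_mem_cellShell hl).1) (fun l hl => (freqNormSq_of_mem_cellShell hl).2)
      (fun l hl => cellCoeff_of_mem hl) ?_
    exact (Finset.mem_erase.1 k.2).1

/-! ## §5 The registered packaging: an exact Euler core at every level `N ≥ 2` -/

/-- **stub_cellCoreTools** (REGISTERED sub-goal of the line `idea-sketch-ideator2`).  The cell core shape `cellCoeff`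
is supported in `modes 2`, and its restriction to EVERY level `N ≥ 2` is a real solenoidal nonzero exact Euler core
(`cellCore_level_four` + the landed `eulerCore_restrict`): the core clause of the heart `stub_loudCoatDecades` /
`stub_steadyTubeLadder` for the cell core, discharged at all levels. [folklore] -/
theorem stub_cellCoreTools : (∀ k ∉ modes (Fin 3) 2, cellCoeff k = 0) ∧ ∀ N : ℕ, 2 ≤ N → (fun k : ↥(modes (Fin 3) N) => cellCoeff k) ∈ galerkinSubspace (modes (Fin 3) N) ∧ (fun k : ↥(modes (Fin 3) N) => cellCoeff k) ≠ 0 ∧ galerkinRHS (modes (Fin 3) N) 0 0 (fun k : ↥(modes (Fin 3) N) => cellCoeff k) = 0 :=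
  have hsupp : ∀ k ∉ modes (Fin 3) 2, cellCoeff k = 0 := fun _ hk =>
    cellCoeff_eq_zero_of_not_mem fun h => hk (cellShell_subset_modes h)
  ⟨hsupp, fun _ hN => eulerCore_restrict hsupp cellCore_level_four hN⟩

/-! ## §6 Hand-off: for the cell core the heart is exactly the steady tube ladder of the fixed cell force -/

open scoped Topology in
/-- **The heart for the cell core, reduced to its open content.**  If for some budgets `E`, `ε > 0`, a loudness ratio
`q ≥ 1`, a viscosity span `r > q²` and force viscosities `a j → 0⁺` there is, for every `j` and frequently in `N`, a
CONNECTED set `Z` of Galerkin steady states of the FIXED cell force `cellCoeff|modes N` with `energy ≤ E`,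
`ε ≤ dissipation ≤ q ε`, whose viscosities cover `[a j, r · a j]`, then the registered heart `stub_loudCoatDecades`
holds (verbatim): `stub_loudCoatOfLadder` with `Cfun := cellCoeff`, `K₀ := 2`, the core clause at every `N ≥ 2` being
`stub_cellCoreTools`. [folklore] -/
theorem loudCoatDecades_of_cellLadder
    (hZ : ∃ (E ε q r : ℝ) (a : ℕ → ℝ), 0 < ε ∧ 1 ≤ q ∧ q ^ 2 < r ∧ (∀ j, 0 < a j) ∧ Tendsto a atTop (𝓝 0) ∧
      ∀ j, ∃ᶠ N in atTop, ∃ Z : Set (ℝ × (↥(modes (Fin 3) N) → EuclideanSpace ℂ (Fin 3))), IsConnected Z ∧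
        (∀ p ∈ Z, p.2 ∈ galerkinSubspace (modes (Fin 3) N) ∧
          galerkinRHS (modes (Fin 3) N) p.1 (fun k : ↥(modes (Fin 3) N) => cellCoeff k) p.2 = 0 ∧
          energy p.2 ≤ E ∧ ε ≤ dissipation p.1 p.2 ∧ dissipation p.1 p.2 ≤ q * ε) ∧
        Set.Icc (a j) (r * a j) ⊆ Prod.fst '' Z) :
    ∃ (K₀ : ℕ) (Cfun : (Fin 3 → ℤ) → EuclideanSpace ℂ (Fin 3)), (∀ k ∉ modes (Fin 3) K₀, Cfun k = 0) ∧
    ∃ (E₁ ε₁ M ρ : ℝ) (νlo : ℕ → ℝ), 0 < ε₁ ∧ 0 < ρ ∧ M < ρ ^ 2 * ε₁ ∧ (∀ j, 0 < νlo j) ∧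
      Tendsto νlo atTop (𝓝 0) ∧
      ∀ j, ∃ᶠ N in atTop, ∃ C : ↥(modes (Fin 3) N) → EuclideanSpace ℂ (Fin 3),
        (C = fun k : ↥(modes (Fin 3) N) => Cfun k) ∧
        (C ∈ galerkinSubspace (modes (Fin 3) N) ∧ C ≠ 0 ∧ galerkinRHS (modes (Fin 3) N) 0 0 C = 0) ∧
        ∃ K : Set (ℝ × (↥(modes (Fin 3) N) → EuclideanSpace ℂ (Fin 3))), IsConnected K ∧
          (∀ p ∈ K, (p.2 ∈ galerkinSubspace (modes (Fin 3) N) ∧ (∑ k, (inner ℂ (C k) (p.2 k)).re) = 0 ∧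
              ∃ s : ℝ, galerkinRHS (modes (Fin 3) N) p.1 0 (C + p.2) = (-s) • C) ∧
            energy (C + p.2) ≤ E₁ ∧ ε₁ ≤ dissipation p.1 (C + p.2) ∧ dissipation p.1 (C + p.2) ≤ M) ∧
          Set.Icc (νlo j) (ρ * νlo j) ⊆ Prod.fst '' K := by
  obtain ⟨E, ε, q, r, a, hε, hq, hqr, ha, hlim, hL⟩ := hZ
  refine stub_loudCoatOfLadder ⟨2, cellCoeff, stub_cellCoreTools.1, E, ε, q, r, a, hε, hq, hqr, ha, hlim, fun j => ?_⟩
  refine ((hL j).and_eventually (eventually_ge_atTop 2)).mono ?_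
  rintro N ⟨⟨Z, hZc, hZst, hcov⟩, hN⟩
  exact ⟨fun k : ↥(modes (Fin 3) N) => cellCoeff k, rfl, stub_cellCoreTools.2 N hN, Z, hZc, hZst, hcov⟩

end Summit.AnomalousDissipation.AnomalousDissipation.Theorems.GalerkinSteadyZerothLaw

end
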